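/-
Copyright (c) 2026 the pub-hodgecm-mathlib formalisation cell (harness21).  Prover seat hodgecm-mathlib-K2E4-p14 (g9), Track B ∕ K2-LIT, h413 = `stmt-HodgeConjecture-24833`,
line `K2_E1_TraceFormulaBeta`, campaign «EIS-R7-BL-SPH-3» — THE MAASS–SELBERG LETTERS ON THE REAL AXIS, FILE 2 (dealer K2E1-plan (g7) (200)∕(216)): the diagonal Maass–Selberg
identity on the LOWER half-plane by REFLECTION at the pairing level, and the reflection principle for a scalar holomorphic on a conj-symmetric domain.
-/
import Summits.HodgeConjecture.HodgeConjecture.Theorems.K2E1MaassSelbergDiagonalFourTermCMThree          -- ★ p859921 (K2E1-p11): `diag_eq_fourTerm_of_pairing_on'`; brings ★ `exists_fourTerm_tube_cm_three`, ★ `pairing_of_differentiableOn`, ★ `differentiableOn_conj_comp_conj`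
import Literature.NumberTheory.EllipticCurves.Gamma1NewformFunctionalEquationProofs                        -- ★ `conj_ofReal_cpow`
import HarnessLib

/-!
# K2·E1 — `K2E1MaassSelbergDiagonalLowerCMThree`: `‖F(ū)‖² = R(u, u; conj ∘ c̃ ∘ conj)` for an `L²`-holomorphic truncated Eisenstein family on a LOWER-half-plane domain, by
# reflection; and the reflection principle for the scalar

Track B ∕ K2-LIT, crux h413 = `stmt-HodgeConjecture-24833`, route of record `HCCMUnconditional`; cell `hodgecm-mathlib`, squad K2, ENGINE E1, campaign EIS-R7-BL-SPH-3.  THEOREMS ONLY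
(no `def`, no `instance`, no notation, no named-fact hypothesis, no `sorry`); lane `--supports stmt-HodgeConjecture-24833 --as helper` (count-neutral).  Closes no socket.

WHAT.  ★ `K2E1MaassSelbergDiagonalFourTermCMThree.normSq_family_eq_fourTerm_on'` proves the diagonal identity `‖F z‖² = R(z, z; c̃)` for a family holomorphic on `D₁ ⊆ D⁺ = {1 < Re, 0 < Im}`.
§2 gives the LOWER twin without re-running any identity theorem of its own: for `D₁ ⊆ D⁻ = {1 < Re, Im < 0}` put `D := conj⁻¹D₁ ⊆ D⁺` and consider the REFLECTED PAIRING
`Φ′(u, u′) := ⟪F ū, F ū′⟫` — holomorphic in `u` (★ `pairing_of_differentiableOn`, second clause), anti-holomorphic in `u′`, and on the sub-tube boxes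
`Φ′(u, u′) = conj (∫ Λ^TẼ(ū)·conj Λ^TẼ(ū′)) = conj R(ū, ū′; c̃) = R(u, u′; c̃♯)` with `c̃♯ := conj ∘ c̃ ∘ conj` (§1 `conj_fourTerm_three`, pure algebra: `T, κ, m, cμ, K` are real).  ★
`diag_eq_fourTerm_of_pairing_on'` on `D` then reads `‖F ū‖² = R(u, u; c̃♯(u))` for `ū ∈ D₁`.  Downstream (FILE 3 `K2E1SphericalEisensteinL2BoundCMThree`) this is fed to FILE 1's bounds with
the scalar `c̃♯`, analytic at `ū₀` when `c̃` is analytic at `u₀`.  §3 is the reflection principle used there for the REAL points: a scalar holomorphic on an open preconnected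
conj-symmetric `U` with `c̃(z̄) = conj c̃(z)` near one point of `U` has it on all of `U`, hence is real on `U ∩ ℝ` (Mathlib's identity theorem).
* §1 `conj_fourTerm_three` — `conj R(ū, ū′; c̃) = R(u, u′; conj ∘ c̃ ∘ conj)`.
* §2 HEAD **`normSq_family_eq_fourTerm_lower_on'`** — ★ :146 VERBATIM with `hD₁sub : D₁ ⊆ {1 < re ∧ im < 0}`; conclusion `∀ u, conj u ∈ D₁ → (‖F (conj u)‖² : ℂ) = R(u, u; conj (c̃ (conj u)))`.
* §3 `conj_apply_conj_eq_of_eventuallyEq`, **`im_apply_ofReal_eq_zero`** — the reflection principle.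
HONEST LABEL: HC_CM is proved only modulo the 7 printed citations (2 remaining named inputs: hLiu418 = `stmt-HodgeConjecture-24832`, h413 = `stmt-HodgeConjecture-24833`) until rung 0
closes; this file asserts no named fact and closes no socket; count-neutral; unconditional (binder form).

## References
* [MoeglinWaldspurger1995] C. Mœglin, J.-L. Waldspurger, *Spectral decomposition and Eisenstein series* (1995), IV.2.3, IV.3.12 (a).
* [Arthur1980TraceFormulaII] J. Arthur, *A trace formula for reductive groups II*, Compositio Math. 40 (1980), §4.
* [BernsteinLapid2019] J. Bernstein, E. Lapid, *On the meromorphic continuation of Eisenstein series*, J. AMS 37 (2024), §4.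
-/

set_option autoImplicit false
-- the mandated namespace repeats `HodgeConjecture.HodgeConjecture`, as in every `Theorems/*.lean` of this sub-problem
set_option linter.dupNamespace false

noncomputable section

open MeasureTheory MeasureTheory.Measure Set NumberField IsDedekindDomain Filter Topology Metric
open scoped NNReal ENNReal ComplexConjugate InnerProductSpace
open Literature.MeasureTheory.Group Literature.NumberTheory
open Literature.NumberTheory.Automorphic Literature.NumberTheory.Automorphic.UnitaryGroup AdelicGroupData
open Literature.NumberTheory.EllipticCurves.ModularForms (conj_ofReal_cpow)
open Summit.HodgeConjecture.HodgeConjecture.Cruxes.H413.K2E1BorelEisensteinU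
open Summit.HodgeConjecture.HodgeConjecture.Cruxes.H413.K2E1BLBorelSpacesU2Defs
open Summit.HodgeConjecture.HodgeConjecture.Cruxes.H413.K2E1MaassSelbergContinuedCMTwo (differentiableOn_conj_comp_conj)
open Summit.HodgeConjecture.HodgeConjecture.Cruxes.H413.K2E1MaassSelbergPairingCMTwo (pairing_of_differentiableOn)
open Summit.HodgeConjecture.HodgeConjecture.Cruxes.H413.K2E1MaassSelbergPairingContinuedCMThree (exists_fourTerm_tube_cm_three)
open Summit.HodgeConjecture.HodgeConjecture.Cruxes.H413.K2E1MaassSelbergDiagonalFourTermCMThree (diag_eq_fourTerm_of_pairing_on')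

namespace Summit.HodgeConjecture.HodgeConjecture.Cruxes.H413.K2E1MaassSelbergDiagonalLowerCMThree

/-! ## §1 Conjugating the four-term -/

/-- **`conj R(ū, ū′; c̃) = R(u, u′; conj ∘ c̃ ∘ conj)`** for the four-term of ★ `exists_fourTerm_tube_cm_three` (`T ≥ 0` and the brackets `cμ, K, κ, m` real). [cite: MoeglinWaldspurger1995, IV.2.3] -/
theorem conj_fourTerm_three (cμ K κ m : ℝ) {T : ℝ} (hT : 0 ≤ T) (φ₀ : ℂ) (c : ℂ → ℂ) (u u' : ℂ) :
    conj (((cμ : ℝ) : ℂ) * (((K : ℝ) : ℂ) *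
        ((((T : ℝ) : ℂ) ^ (conj u + conj (conj u') - 2) / (conj u + conj (conj u') - 2)) * (((κ : ℝ) : ℂ) * (((m : ℝ) : ℂ) * (φ₀ * conj φ₀)))
          + (((T : ℝ) : ℂ) ^ (conj u - conj (conj u')) / (conj u - conj (conj u'))) * (((κ : ℝ) : ℂ) * (((m : ℝ) : ℂ) * (φ₀ * conj (c (conj u') * φ₀))))
          - (((T : ℝ) : ℂ) ^ (-(conj u - conj (conj u'))) / (conj u - conj (conj u'))) * (((κ : ℝ) : ℂ) * (((m : ℝ) : ℂ) * (c (conj u) * φ₀ * conj φ₀)))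
          - (((T : ℝ) : ℂ) ^ (-(conj u + conj (conj u') - 2)) / (conj u + conj (conj u') - 2)) * (((κ : ℝ) : ℂ) * (((m : ℝ) : ℂ) * (c (conj u) * φ₀ * conj (c (conj u') * φ₀))))))) =
      ((cμ : ℝ) : ℂ) * (((K : ℝ) : ℂ) *
        ((((T : ℝ) : ℂ) ^ (u + conj u' - 2) / (u + conj u' - 2)) * (((κ : ℝ) : ℂ) * (((m : ℝ) : ℂ) * (φ₀ * conj φ₀)))
          + (((T : ℝ) : ℂ) ^ (u - conj u') / (u - conj u')) * (((κ : ℝ) : ℂ) * (((m : ℝ) : ℂ) * (φ₀ * conj (conj (c (conj u')) * φ₀))))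
          - (((T : ℝ) : ℂ) ^ (-(u - conj u')) / (u - conj u')) * (((κ : ℝ) : ℂ) * (((m : ℝ) : ℂ) * (conj (c (conj u)) * φ₀ * conj φ₀)))
          - (((T : ℝ) : ℂ) ^ (-(u + conj u' - 2)) / (u + conj u' - 2)) * (((κ : ℝ) : ℂ) * (((m : ℝ) : ℂ) * (conj (c (conj u)) * φ₀ * conj (conj (c (conj u')) * φ₀)))))) := by
  simp only [map_mul, map_add, map_sub, map_div₀, map_neg, map_ofNat, conj_ofReal_cpow hT, Complex.conj_ofReal, Complex.conj_conj]
  ring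

/-! ## §2 The diagonal identity on a lower-half-plane domain, by reflection -/

section Family

variable (L : Type) [Field L] [NumberField L] [IsCMField L]
variable [MeasurableSpace (quasiSplit (↥(maximalRealSubfield L)) L (IsCMField.complexConj L) 3).Adelic] [BorelSpace (quasiSplit (↥(maximalRealSubfield L)) L (IsCMField.complexConj L) 3).Adelic]
variable [MeasurableSpace (AdeleRing (𝓞 L) L)ˣ] [BorelSpace (AdeleRing (𝓞 L) L)ˣ]

/-- **`‖F ū‖² = R(u, u; conj ∘ c̃ ∘ conj)` FOR AN `L²`-HOLOMORPHIC FAMILY ON A LOWER-HALF-PLANE DOMAIN** — the binders of ★ `normSq_family_eq_fourTerm_on'` VERBATIM except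
`hD₁sub : D₁ ⊆ {1 < Re, Im < 0}`; conclusion for every `u` with `ū ∈ D₁`.  Proof: the reflected pairing `Φ′(u, u′) = ⟪F ū, F ū′⟫` on `D = conj⁻¹D₁ ⊆ D⁺` is holomorphic in `u`,
anti-holomorphic in `u′` (★ `pairing_of_differentiableOn`), equals `conj R(ū, ū′; c̃) = R(u, u′; c̃♯)` on the reflected boxes (★ `exists_fourTerm_tube_cm_three`, §1), so ★
`diag_eq_fourTerm_of_pairing_on'` applies on `D`. [cite: MoeglinWaldspurger1995, IV.2.3, IV.3.12 (a)] [cite: BernsteinLapid2019, §4] -/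
theorem normSq_family_eq_fourTerm_lower_on' {D₁ : Set ℂ} (hD₁ : IsOpen D₁) (hD₁c : IsPreconnected D₁) (hD₁sub : D₁ ⊆ {z : ℂ | 1 < z.re ∧ z.im < 0})
    {O₁ O₂' : Set ℂ} (hO₁ : IsOpen O₁) (hO₁ne : O₁.Nonempty) (hO₁D : O₁ ⊆ D₁) (hO₂' : IsOpen O₂') (hO₂'ne : O₂'.Nonempty) (hO₂'D : O₂' ⊆ D₁)
    (hsep : ∀ z ∈ O₁, ∀ z' ∈ O₂', 2 < z'.re ∧ z'.re < z.re)
    (μ : Measure (quasiSplit (↥(maximalRealSubfield L)) L (IsCMField.complexConj L) 3).automorphicQuotient) [(quasiSplit (↥(maximalRealSubfield L)) L (IsCMField.complexConj L) 3).IsAutomorphicMeasure μ]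
    (νG : Measure (quasiSplit (↥(maximalRealSubfield L)) L (IsCMField.complexConj L) 3).Adelic) [νG.IsHaarMeasure] [νG.IsInvInvariant]
    (μK : Measure ((standardMaximalCompactGL 3 L).comap (adelicVal (↥(maximalRealSubfield L)) L (IsCMField.complexConj L) 3 ((StdForm.antidiagonal 3).over L)) : Subgroup (quasiSplit (↥(maximalRealSubfield L)) L (IsCMField.complexConj L) 3).Adelic))
    [μK.IsHaarMeasure]
    (νI : Measure (AdeleRing (𝓞 L) L)ˣ) [νI.IsHaarMeasure]
    {𝓕I : Set (AdeleRing (𝓞 L) L)ˣ} (h𝓕I : IsIdeleClassDomain L 𝓕I)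
    (ν : Measure ↥(adelicUnipotent (↥(maximalRealSubfield L)) L (IsCMField.complexConj L) 3)) [ν.IsHaarMeasure]
    {𝓕 : Set ↥(adelicUnipotent (↥(maximalRealSubfield L)) L (IsCMField.complexConj L) 3)} (h𝓕N : IsFundamentalDomain ↥(rationalUnipotent (↥(maximalRealSubfield L)) L (IsCMField.complexConj L) 3) 𝓕 ν) (h𝓕1 : ν 𝓕 = 1)
    (h𝓕c : IsCompact (closure 𝓕))
    {T : ℝ≥0} (hT : 1 ≤ T) {φ₀ : ℂ}
    {β : (quasiSplit (↥(maximalRealSubfield L)) L (IsCMField.complexConj L) 3).Adelic → ℝ≥0∞} (hβ : IsCoveringWeight ((arithmeticBorel (↥(maximalRealSubfield L)) L (IsCMField.complexConj L) 3).map (quasiSplit (↥(maximalRealSubfield L)) L (IsCMField.complexConj L) 3).arithmeticSubgroup.subtype) β)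
    {c : ℂ → ℂ} (hc : DifferentiableOn ℂ c D₁) (hceq : ∀ z : ℂ, 2 < z.re → c z = (∫ v : ↥(adelicUnipotent (↥(maximalRealSubfield L)) L (IsCMField.complexConj L) 3), (((borelHeight ((quasiSplit (↥(maximalRealSubfield L)) L (IsCMField.complexConj L) 3).toAdelic (weylLongU ((IsCMField.complexConj L : L ≃ₐ[↥(maximalRealSubfield L)] L) : L →+* L) (rfl : (StdForm.antidiagonal 3).over L = (StdForm.antidiagonal 3).over L)) * (v : (quasiSplit (↥(maximalRealSubfield L)) L (IsCMField.complexConj L) 3).Adelic))) : ℝ) : ℂ) ^ z ∂ν))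
    (F : ℂ → Lp ℂ 2 μ) (hFd : DifferentiableOn ℂ F D₁)
    (hFtube : ∀ z ∈ D₁, 2 < z.re → ((F z : Lp ℂ 2 μ) : (quasiSplit (↥(maximalRealSubfield L)) L (IsCMField.complexConj L) 3).automorphicQuotient → ℂ) =ᵐ[μ] (quasiSplit (↥(maximalRealSubfield L)) L (IsCMField.complexConj L) 3).quotFun (truncation ν 𝓕 T (eisensteinSeriesU (flatSectionU (fun _ : (quasiSplit (↥(maximalRealSubfield L)) L (IsCMField.complexConj L) 3).Adelic => φ₀) z)))) :
    ∃ cμ K : ℝ, 0 < cμ ∧ 0 < K ∧ ∀ u : ℂ, conj u ∈ D₁ → (((‖F (conj u)‖ ^ 2 : ℝ)) : ℂ) =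
      ((cμ : ℝ) : ℂ) * (((K : ℝ) : ℂ) *
        ((((T : ℝ) : ℂ) ^ (u + conj u - 2) / (u + conj u - 2)) * ((((∫ x in {x : (AdeleRing (𝓞 L) L)ˣ | (IdeleClassGroup.ideleNorm L x : ℝ) ≤ 1} ∩ 𝓕I, (IdeleClassGroup.ideleNorm L x : ℝ) ∂νI) : ℝ) : ℂ) * (((μK.real Set.univ : ℝ) : ℂ) * (φ₀ * conj φ₀)))
          + (((T : ℝ) : ℂ) ^ (u - conj u) / (u - conj u)) * ((((∫ x in {x : (AdeleRing (𝓞 L) L)ˣ | (IdeleClassGroup.ideleNorm L x : ℝ) ≤ 1} ∩ 𝓕I, (IdeleClassGroup.ideleNorm L x : ℝ) ∂νI) : ℝ) : ℂ) * (((μK.real Set.univ : ℝ) : ℂ) * (φ₀ * conj (conj (c (conj u)) * φ₀))))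
          - (((T : ℝ) : ℂ) ^ (-(u - conj u)) / (u - conj u)) * ((((∫ x in {x : (AdeleRing (𝓞 L) L)ˣ | (IdeleClassGroup.ideleNorm L x : ℝ) ≤ 1} ∩ 𝓕I, (IdeleClassGroup.ideleNorm L x : ℝ) ∂νI) : ℝ) : ℂ) * (((μK.real Set.univ : ℝ) : ℂ) * (conj (c (conj u)) * φ₀ * conj φ₀)))
          - (((T : ℝ) : ℂ) ^ (-(u + conj u - 2)) / (u + conj u - 2)) * ((((∫ x in {x : (AdeleRing (𝓞 L) L)ˣ | (IdeleClassGroup.ideleNorm L x : ℝ) ≤ 1} ∩ 𝓕I, (IdeleClassGroup.ideleNorm L x : ℝ) ∂νI) : ℝ) : ℂ) * (((μK.real Set.univ : ℝ) : ℂ) * (conj (c (conj u)) * φ₀ * conj (conj (c (conj u)) * φ₀)))))) := by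
  -- the reflected domain `D = conj⁻¹ D₁ ⊆ D⁺`
  set D : Set ℂ := {u : ℂ | conj u ∈ D₁} with hDdef
  have hDo : IsOpen D := hD₁.preimage Complex.continuous_conj
  have hDc : IsPreconnected D := by
    have h1 : D = (fun z : ℂ => conj z) '' D₁ := by
      ext w
      refine ⟨fun hw => ⟨conj w, hw, Complex.conj_conj w⟩, ?_⟩
      rintro ⟨z, hz1, rfl⟩
      show conj (conj z) ∈ D₁
      rw [Complex.conj_conj]; exact hz1
    rw [h1]
    exact hD₁c.image _ Complex.continuous_conj.continuousOn
  have hDsub : D ⊆ {z : ℂ | 1 < z.re ∧ 0 < z.im} := fun u hu => by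
    obtain ⟨h1, h2⟩ := hD₁sub hu
    rw [Complex.conj_re] at h1
    rw [Complex.conj_im] at h2
    exact ⟨h1, by linarith⟩
  -- the reflected boxes
  have hP₁o : IsOpen {u : ℂ | conj u ∈ O₁} := hO₁.preimage Complex.continuous_conj
  have hP₁ne : ({u : ℂ | conj u ∈ O₁} : Set ℂ).Nonempty := by
    obtain ⟨z, hz⟩ := hO₁ne
    exact ⟨conj z, show conj (conj z) ∈ O₁ by rw [Complex.conj_conj]; exact hz⟩
  have hP₁D : {u : ℂ | conj u ∈ O₁} ⊆ D := fun u hu => hO₁D hu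
  have hP₂o : IsOpen {u : ℂ | conj u ∈ O₂'} := hO₂'.preimage Complex.continuous_conj
  have hP₂ne : ({u : ℂ | conj u ∈ O₂'} : Set ℂ).Nonempty := by
    obtain ⟨z, hz⟩ := hO₂'ne
    exact ⟨conj z, show conj (conj z) ∈ O₂' by rw [Complex.conj_conj]; exact hz⟩
  have hP₂D : {u : ℂ | conj u ∈ O₂'} ⊆ D := fun u hu => hO₂'D hu
  have hsep' : ∀ u ∈ {u : ℂ | conj u ∈ O₁}, ∀ u' ∈ {u : ℂ | conj u ∈ O₂'}, 2 < u'.re ∧ u'.re < u.re := fun u hu u' hu' => by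
    have h := hsep (conj u) hu (conj u') hu'
    rwa [Complex.conj_re, Complex.conj_re] at h
  -- the reflected scalar and the reflected pairing
  have hc' : DifferentiableOn ℂ (fun u : ℂ => conj (c (conj u))) D := differentiableOn_conj_comp_conj hD₁ hc
  obtain ⟨hΦ₁, hΦ₂, hQ⟩ := pairing_of_differentiableOn hD₁ hFd
  have hset : {w : ℂ | conj w ∈ D} = D₁ := by
    ext w
    simp only [hDdef, Set.mem_setOf_eq, Complex.conj_conj]
  have hΨ₁ : ∀ u' ∈ D, DifferentiableOn ℂ (fun u : ℂ => ⟪F (conj u), F (conj u')⟫_ℂ) D := fun u' hu' => hΦ₂ (conj u') hu'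
  have hΨ₂ : ∀ u ∈ D, DifferentiableOn ℂ (fun w : ℂ => ⟪F (conj u), F (conj (conj w))⟫_ℂ) {w : ℂ | conj w ∈ D} := fun u hu => by
    rw [hset]
    exact (hΦ₁ (conj u) hu).congr fun w _ => by rw [Complex.conj_conj]
  -- the tube four-term and the reflected relation on the boxes
  obtain ⟨cμ, K, hcμ, hK, h4⟩ := exists_fourTerm_tube_cm_three L μ νG μK νI h𝓕I ν h𝓕N h𝓕1 h𝓕c T hT φ₀ hβ c hceq
  have hT0 : (0 : ℝ) ≤ (T : ℝ) := T.coe_nonneg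
  have hrel : ∀ u ∈ D, ∀ u' ∈ D, 2 < u'.re → u'.re < u.re → ⟪F (conj u), F (conj u')⟫_ℂ =
      ((cμ : ℝ) : ℂ) * (((K : ℝ) : ℂ) *
        ((((T : ℝ) : ℂ) ^ (u + conj u' - 2) / (u + conj u' - 2)) * ((((∫ x in {x : (AdeleRing (𝓞 L) L)ˣ | (IdeleClassGroup.ideleNorm L x : ℝ) ≤ 1} ∩ 𝓕I, (IdeleClassGroup.ideleNorm L x : ℝ) ∂νI) : ℝ) : ℂ) * (((μK.real Set.univ : ℝ) : ℂ) * (φ₀ * conj φ₀)))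
          + (((T : ℝ) : ℂ) ^ (u - conj u') / (u - conj u')) * ((((∫ x in {x : (AdeleRing (𝓞 L) L)ˣ | (IdeleClassGroup.ideleNorm L x : ℝ) ≤ 1} ∩ 𝓕I, (IdeleClassGroup.ideleNorm L x : ℝ) ∂νI) : ℝ) : ℂ) * (((μK.real Set.univ : ℝ) : ℂ) * (φ₀ * conj (conj (c (conj u')) * φ₀))))
          - (((T : ℝ) : ℂ) ^ (-(u - conj u')) / (u - conj u')) * ((((∫ x in {x : (AdeleRing (𝓞 L) L)ˣ | (IdeleClassGroup.ideleNorm L x : ℝ) ≤ 1} ∩ 𝓕I, (IdeleClassGroup.ideleNorm L x : ℝ) ∂νI) : ℝ) : ℂ) * (((μK.real Set.univ : ℝ) : ℂ) * (conj (c (conj u)) * φ₀ * conj φ₀)))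
          - (((T : ℝ) : ℂ) ^ (-(u + conj u' - 2)) / (u + conj u' - 2)) * ((((∫ x in {x : (AdeleRing (𝓞 L) L)ˣ | (IdeleClassGroup.ideleNorm L x : ℝ) ≤ 1} ∩ 𝓕I, (IdeleClassGroup.ideleNorm L x : ℝ) ∂νI) : ℝ) : ℂ) * (((μK.real Set.univ : ℝ) : ℂ) * (conj (c (conj u)) * φ₀ * conj (conj (c (conj u')) * φ₀)))))) := by
    intro u hu u' hu' h1 h2
    have h1' : 2 < (conj u').re := by rwa [Complex.conj_re]
    have h2' : (conj u').re < (conj u).re := by rwa [Complex.conj_re, Complex.conj_re]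
    have hint : ⟪F (conj u), F (conj u')⟫_ℂ = conj (∫ x, (quasiSplit (↥(maximalRealSubfield L)) L (IsCMField.complexConj L) 3).quotFun (truncation ν 𝓕 T (eisensteinSeriesU (flatSectionU (fun _ : (quasiSplit (↥(maximalRealSubfield L)) L (IsCMField.complexConj L) 3).Adelic => φ₀) (conj u)))) x *
        conj ((quasiSplit (↥(maximalRealSubfield L)) L (IsCMField.complexConj L) 3).quotFun (truncation ν 𝓕 T (eisensteinSeriesU (flatSectionU (fun _ : (quasiSplit (↥(maximalRealSubfield L)) L (IsCMField.complexConj L) 3).Adelic => φ₀) (conj u')))) x) ∂μ) := by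
      rw [← integral_conj, MeasureTheory.L2.inner_def]
      refine integral_congr_ae ?_
      filter_upwards [hFtube (conj u) hu (h1'.trans h2'), hFtube (conj u') hu' h1'] with x hx hx'
      rw [hx, hx', RCLike.inner_apply, map_mul, Complex.conj_conj, mul_comm]
    rw [hint, h4 (conj u) (conj u') h1' h2']
    exact conj_fourTerm_three cμ K _ _ hT0 φ₀ c u u'
  refine ⟨cμ, K, hcμ, hK, fun u hu => ?_⟩
  rw [← (hQ (conj u) hu).2]
  exact diag_eq_fourTerm_of_pairing_on' hDo hDc hDsub hP₁o hP₁ne hP₁D hP₂o hP₂ne hP₂D hsep' (T := (T : ℝ)) (by exact_mod_cast hT) hc'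
    (Φ := fun u u' => ⟪F (conj u), F (conj u')⟫_ℂ) hΨ₁ hΨ₂ hrel hu

end Family

/-! ## §3 The reflection principle for the scalar -/

/-- **REFLECTION PRINCIPLE**: `c` holomorphic on an open preconnected conj-symmetric `U` with `c(z̄) = conj c(z)` near ONE point of `U` satisfies it on all of `U` (Mathlib's identity
theorem for `c` and `conj ∘ c ∘ conj`, ★ `differentiableOn_conj_comp_conj`). [folklore] -/
theorem conj_apply_conj_eq_of_eventuallyEq {U : Set ℂ} (hUo : IsOpen U) (hUc : IsPreconnected U) (hUsymm : ∀ z ∈ U, conj z ∈ U)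
    {c : ℂ → ℂ} (hc : DifferentiableOn ℂ c U) {z₁ : ℂ} (hz₁ : z₁ ∈ U) (hsymm : ∀ᶠ z in 𝓝 z₁, c (conj z) = conj (c z)) :
    ∀ z ∈ U, c (conj z) = conj (c z) := by
  have hset : {w : ℂ | conj w ∈ U} = U :=
    Set.ext fun w => ⟨fun hw => by simpa only [Complex.conj_conj] using hUsymm _ hw, fun hw => hUsymm w hw⟩
  have hg : DifferentiableOn ℂ (fun u : ℂ => conj (c (conj u))) U := by
    have h := differentiableOn_conj_comp_conj hUo hc
    rwa [hset] at h
  have hfg : (fun u : ℂ => conj (c (conj u))) =ᶠ[𝓝 z₁] c := by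
    filter_upwards [hsymm] with z hz
    rw [hz, Complex.conj_conj]
  have hid := (hg.analyticOnNhd hUo).eqOn_of_preconnected_of_eventuallyEq (hc.analyticOnNhd hUo) hUc hz₁ hfg
  intro z hz
  have h := hid (hUsymm z hz)
  simp only [Complex.conj_conj] at h
  exact h.symm

/-- **A SCALAR WITH `c(z̄) = conj c(z)` ON A CONJ-SYMMETRIC `U` IS REAL AT THE REAL POINTS OF `U`**. [folklore] -/
theorem im_apply_ofReal_eq_zero {U : Set ℂ} (hUo : IsOpen U) (hUc : IsPreconnected U) (hUsymm : ∀ z ∈ U, conj z ∈ U)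
    {c : ℂ → ℂ} (hc : DifferentiableOn ℂ c U) {z₁ : ℂ} (hz₁ : z₁ ∈ U) (hsymm : ∀ᶠ z in 𝓝 z₁, c (conj z) = conj (c z))
    {x : ℝ} (hx : (x : ℂ) ∈ U) : (c (x : ℂ)).im = 0 := by
  have h := conj_apply_conj_eq_of_eventuallyEq hUo hUc hUsymm hc hz₁ hsymm (x : ℂ) hx
  rw [Complex.conj_ofReal] at h
  exact Complex.conj_eq_iff_im.1 h.symm

end Summit.HodgeConjecture.HodgeConjecture.Cruxes.H413.K2E1MaassSelbergDiagonalLowerCMThree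

end
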